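import Summits.CriticalPhenomena.PercolationContinuityZ3.Theorems.PercLevyKhintchineSmallPNegTypeKernels
import HarnessLib

/-!
# `PercLevyKhintchine.SmallPNegType` (stmt-CriticalPhenomena-2171) — kernel lemmas II: `1/(1+μ‖x−y‖₁)` is positive
# semi-definite, `log(1+λ‖x−y‖₁)` is of negative type, and `Σ c_i c_j log(‖x_i−x_j‖₁!) ≥ 0` on the null directions

RSW3 lane (lead, gen 30).  Sequel of `…SmallPNegTypeKernels` (helper lemmas for item `stmt-CriticalPhenomena-2171`): from the
positive semi-definiteness of `r^{‖x−y‖₁}` (part I) by one-variable calculus —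

* `sum_sum_mul_inv_one_add_nonneg` — `1/(1+μ‖x−y‖₁) = ∫_0^∞ e^{−u}(e^{−μu})^{‖x−y‖₁} du` is positive semi-definite (`μ ≥ 0`);
* `sum_sum_mul_log_one_add_nonpos` — `log(1+λ‖x−y‖₁) = ∫_0^1 λd/(1+vλd) dv`, `λd/(1+vλd) = (1 − 1/(1+vλd))/v`, is of
  negative type (`λ ≥ 0`): a Bernstein function of a kernel of negative type;
* `log_factorial_eq_sum` — the truncated Euler product `log d! = −Σ_{k<N} log(1 + d/(k+1)) + d log N + Σ_{j<d} log(1+(j+1)/N)`;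
* `sum_sum_mul_log_factorial_nonneg` — ON THE NULL DIRECTIONS of the `ℓ¹` form (all axis-level sums of `c` vanish, `Σ c = 0`)
  `Σ c_i c_j log(‖x_i − x_j‖₁!) ≥ 0`: the first part of the Euler product contributes `≥ 0`, the linear part vanishes there,
  the remainder is `O(1/N)`.
Since `log N(v) = log(‖v‖₁!) − Σ_k log(|v_k|!)` and the coordinate terms vanish on the null directions (part I,
`sum_sum_coord_eq_zero`), this is the non-negativity of the second-order term of `Σ c_i c_j log τ_p(x_i,x_j)` as `p → 0`.
What remains for the item: the small-`p` asymptotics of `τ_p` (path counting), STRICT positivity on the null directions for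
distinct points (same integrals, `E_t → I`), and a compactness argument on the unit sphere of `{Σ c = 0}`.
No definitions, no sorries.

References: C. Berg, J. P. R. Christensen, P. Ressel, *Harmonic Analysis on Semigroups* (1984), Ch. 3 §2, Ch. 4 §4
[BergChristensenRessel1984]; M. Deza, M. Laurent (1997), §6.1 [DezaLaurent1997].
-/

noncomputable section

namespace Summit.CriticalPhenomena.PercolationContinuityZ3.Theorems

namespace SmallPNegType

open Finset Literature.Probability.LatticeModels

/-! ### Consequences: `1/(1 + μ‖x−y‖₁)` is positive semi-definite and `log(1 + λ‖x−y‖₁)` is of negative type -/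

/-- `Σ_{i,j} c_i c_j / (1 + μ ‖x_i − x_j‖₁) ≥ 0` for `μ ≥ 0`: `1/(1+μd) = ∫_0^∞ e^{−u} (e^{−μu})^d du` is a mixture of the
kernels `r^{‖x−y‖₁}`. [cite: BergChristensenRessel1984, Ch. 3, §2 (mixtures of positive definite kernels)] -/
theorem sum_sum_mul_inv_one_add_nonneg {n : ℕ} (x : Fin n → Site 3) (c : Fin n → ℝ) {μ : ℝ} (hμ : 0 ≤ μ) :
    0 ≤ ∑ i, ∑ j, c i * c j * (1 + μ * ((∑ k, (x i k - x j k).natAbs : ℕ) : ℝ))⁻¹ := by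
  have hexp : ∀ (d : ℕ) (u : ℝ), Real.exp (-u) * Real.exp (-(μ * u)) ^ d = Real.exp (-(1 + μ * d) * u) := by
    intro d u
    rw [← Real.exp_nat_mul, ← Real.exp_add]
    congr 1
    ring
  have hrep : ∀ d : ℕ, (1 + μ * (d : ℝ))⁻¹ = ∫ u in Set.Ioi (0 : ℝ), Real.exp (-u) * Real.exp (-(μ * u)) ^ d := by
    intro d
    have hpos : 0 < 1 + μ * (d : ℝ) := by positivity
    simp_rw [hexp d]
    rw [integral_exp_mul_Ioi (by linarith) 0, mul_zero, Real.exp_zero, neg_div_neg_eq, one_div]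
  have hint : ∀ i j, MeasureTheory.IntegrableOn
      (fun u : ℝ => c i * c j * (Real.exp (-u) * Real.exp (-(μ * u)) ^ (∑ k, (x i k - x j k).natAbs)))
      (Set.Ioi 0) := by
    intro i j
    have hpos : 0 < 1 + μ * ((∑ k, (x i k - x j k).natAbs : ℕ) : ℝ) := by positivity
    have h1 : (fun u : ℝ => c i * c j * (Real.exp (-u) * Real.exp (-(μ * u)) ^ (∑ k, (x i k - x j k).natAbs))) =
        fun u => c i * c j * Real.exp (-(1 + μ * ((∑ k, (x i k - x j k).natAbs : ℕ) : ℝ)) * u) := by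
      funext u; rw [hexp]
    rw [h1]
    exact (exp_neg_integrableOn_Ioi 0 hpos).const_mul _
  calc (0 : ℝ) ≤ ∫ u in Set.Ioi (0 : ℝ), ∑ i, ∑ j,
        c i * c j * (Real.exp (-u) * Real.exp (-(μ * u)) ^ (∑ k, (x i k - x j k).natAbs)) := by
        refine MeasureTheory.setIntegral_nonneg measurableSet_Ioi fun u hu => ?_
        have h1 : ∑ i, ∑ j, c i * c j * (Real.exp (-u) * Real.exp (-(μ * u)) ^ (∑ k, (x i k - x j k).natAbs)) =
            Real.exp (-u) * ∑ i, ∑ j, c i * c j * Real.exp (-(μ * u)) ^ (∑ k, (x i k - x j k).natAbs) := by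
          rw [Finset.mul_sum]
          refine Finset.sum_congr rfl fun i _ => ?_
          rw [Finset.mul_sum]
          refine Finset.sum_congr rfl fun j _ => ?_
          ring
        rw [h1]
        refine mul_nonneg (Real.exp_pos _).le (sum_sum_mul_pow_l1_nonneg x c ?_ ?_)
        · exact Real.exp_le_one_iff.2 (by nlinarith [Set.mem_Ioi.1 hu])
        · linarith [Real.exp_pos (-(μ * u))]
    _ = ∑ i, ∑ j, c i * c j * (1 + μ * ((∑ k, (x i k - x j k).natAbs : ℕ) : ℝ))⁻¹ := by
        rw [MeasureTheory.integral_finsetSum _ fun i _ => MeasureTheory.integrable_finsetSum _ fun j _ => hint i j]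
        refine Finset.sum_congr rfl fun i _ => ?_
        rw [MeasureTheory.integral_finsetSum _ fun j _ => hint i j]
        refine Finset.sum_congr rfl fun j _ => ?_
        rw [MeasureTheory.integral_const_mul, hrep]

/-- **`log(1 + λ‖x−y‖₁)` is of negative type on `ℤ³`** (`λ ≥ 0`): `Σ_{i,j} c_i c_j log(1 + λ‖x_i−x_j‖₁) ≤ 0` when
`Σ c_i = 0` — a Bernstein function of a kernel of negative type; here from `log(1+s) = ∫_0^1 s/(1+vs) dv` and
`s/(1+vs) = (1 − 1/(1+vs))/v`. [cite: BergChristensenRessel1984, Ch. 3, §2; Ch. 4, §4 (Bernstein functions)] -/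
theorem sum_sum_mul_log_one_add_nonpos {n : ℕ} (x : Fin n → Site 3) (c : Fin n → ℝ) (hc : ∑ i, c i = 0)
    {l : ℝ} (hl : 0 ≤ l) :
    ∑ i, ∑ j, c i * c j * Real.log (1 + l * ((∑ k, (x i k - x j k).natAbs : ℕ) : ℝ)) ≤ 0 := by
  -- `log (1 + s) = ∫_0^1 s / (1 + v s) dv`
  have hlog : ∀ s : ℝ, 0 ≤ s → Real.log (1 + s) = ∫ v in (0 : ℝ)..1, s / (1 + v * s) := by
    intro s hs
    have hderiv : ∀ v ∈ Set.uIcc (0 : ℝ) 1, HasDerivAt (fun v => Real.log (1 + v * s)) (s / (1 + v * s)) v := by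
      intro v hv
      rw [Set.uIcc_of_le zero_le_one] at hv
      have hpos : 0 < 1 + v * s := by have := hv.1; positivity
      have h := (((hasDerivAt_id v).mul_const s).const_add 1).log hpos.ne'
      simp only [id, one_mul] at h
      exact h
    have hcont : IntervalIntegrable (fun v => s / (1 + v * s)) MeasureTheory.volume 0 1 := by
      refine ContinuousOn.intervalIntegrable ?_
      rw [Set.uIcc_of_le zero_le_one]
      refine continuousOn_const.div (by fun_prop) fun v hv => ?_
      have := hv.1
      positivity
    rw [intervalIntegral.integral_eq_sub_of_hasDerivAt hderiv hcont]
    simp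
  set d : Fin n → Fin n → ℕ := fun i j => ∑ k, (x i k - x j k).natAbs with hd
  have hterm : ∀ i j, c i * c j * Real.log (1 + l * (d i j : ℝ)) =
      ∫ v in (0 : ℝ)..1, c i * c j * ((l * d i j) / (1 + v * (l * d i j))) := by
    intro i j
    rw [hlog _ (by positivity), intervalIntegral.integral_const_mul]
  have hii : ∀ i j, IntervalIntegrable (fun v : ℝ => c i * c j * ((l * d i j) / (1 + v * (l * d i j))))
      MeasureTheory.volume 0 1 := by
    intro i j
    refine ContinuousOn.intervalIntegrable ?_
    rw [Set.uIcc_of_le zero_le_one]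
    refine continuousOn_const.mul (continuousOn_const.div (by fun_prop) fun v hv => ?_)
    have := hv.1
    positivity
  have hswap : ∑ i, ∑ j, c i * c j * Real.log (1 + l * (d i j : ℝ)) =
      ∫ v in (0 : ℝ)..1, ∑ i, ∑ j, c i * c j * ((l * d i j) / (1 + v * (l * d i j))) := by
    have hrow : ∀ i, IntervalIntegrable (fun v : ℝ => ∑ j, c i * c j * ((l * d i j) / (1 + v * (l * d i j))))
        MeasureTheory.volume 0 1 := by
      intro i
      have h := IntervalIntegrable.sum Finset.univ fun j _ => hii i j
      simpa only [Finset.sum_fn] using h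
    rw [intervalIntegral.integral_finsetSum fun i _ => hrow i]
    refine Finset.sum_congr rfl fun i _ => ?_
    rw [intervalIntegral.integral_finsetSum fun j _ => hii i j]
    exact Finset.sum_congr rfl fun j _ => hterm i j
  rw [hswap, intervalIntegral.integral_of_le zero_le_one]
  refine MeasureTheory.setIntegral_nonpos measurableSet_Ioc fun v hv => ?_
  have hv0 : 0 < v := hv.1
  have hid : ∀ i j, c i * c j * ((l * d i j) / (1 + v * (l * d i j))) =
      v⁻¹ * (c i * c j) - v⁻¹ * (c i * c j * (1 + (v * l) * (d i j : ℝ))⁻¹) := by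
    intro i j
    have hpos : 0 < 1 + v * (l * d i j) := by positivity
    have hpos' : 0 < 1 + v * l * (d i j : ℝ) := by positivity
    field_simp
    ring
  have hA : ∑ i, ∑ j, v⁻¹ * (c i * c j) = v⁻¹ * ((∑ i, c i) * ∑ j, c j) := by
    rw [Finset.sum_mul_sum, Finset.mul_sum]
    refine Finset.sum_congr rfl fun i _ => ?_
    rw [Finset.mul_sum]
  have hB : ∑ i, ∑ j, v⁻¹ * (c i * c j * (1 + (v * l) * (d i j : ℝ))⁻¹) =
      v⁻¹ * ∑ i, ∑ j, c i * c j * (1 + (v * l) * (d i j : ℝ))⁻¹ := by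
    rw [Finset.mul_sum]
    refine Finset.sum_congr rfl fun i _ => ?_
    rw [Finset.mul_sum]
  calc ∑ i, ∑ j, c i * c j * ((l * d i j) / (1 + v * (l * d i j)))
      = ∑ i, ∑ j, (v⁻¹ * (c i * c j) - v⁻¹ * (c i * c j * (1 + (v * l) * (d i j : ℝ))⁻¹)) :=
        Finset.sum_congr rfl fun i _ => Finset.sum_congr rfl fun j _ => hid i j
    _ = v⁻¹ * ((∑ i, c i) * ∑ j, c j) - v⁻¹ * ∑ i, ∑ j, c i * c j * (1 + (v * l) * (d i j : ℝ))⁻¹ := by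
        simp only [Finset.sum_sub_distrib, hA, hB]
    _ ≤ 0 := by
        rw [hc, zero_mul, mul_zero, zero_sub, neg_nonpos]
        exact mul_nonneg (inv_nonneg.2 hv0.le) (sum_sum_mul_inv_one_add_nonneg x c (by positivity))

/-! ### The second-order form on the null directions: `Σ c_i c_j log(‖x_i − x_j‖₁!) ≥ 0` -/

/-- Euler's product for the factorial, truncated: for `N ≥ 1`,
`log d! = −Σ_{k<N} log(1 + d/(k+1)) + d log N + Σ_{j<d} log(1 + (j+1)/N)`. [folklore] -/
theorem log_factorial_eq_sum (d : ℕ) {N : ℕ} (hN : 1 ≤ N) :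
    Real.log (d.factorial : ℝ) = -(∑ k ∈ Finset.range N, Real.log (1 + ((k : ℝ) + 1)⁻¹ * d)) + d * Real.log N
      + ∑ j ∈ Finset.range d, Real.log (1 + ((j : ℝ) + 1) / N) := by
  have hN0 : (0 : ℝ) < N := by exact_mod_cast hN
  induction d with
  | zero => simp
  | succ d ih =>
    rw [Nat.factorial_succ, Nat.cast_mul, Real.log_mul (by positivity) (by positivity), ih, Finset.sum_range_succ]
    have hstep : ∀ k ∈ Finset.range N, Real.log (1 + ((k : ℝ) + 1)⁻¹ * ((d + 1 : ℕ) : ℝ)) -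
        Real.log (1 + ((k : ℝ) + 1)⁻¹ * (d : ℝ)) =
        Real.log (((k + 1 : ℕ) : ℝ) + d + 1) - Real.log ((k : ℝ) + d + 1) := by
      intro k _
      have hk : (0 : ℝ) < k + 1 := by positivity
      have e1 : 1 + ((k : ℝ) + 1)⁻¹ * ((d + 1 : ℕ) : ℝ) = (((k + 1 : ℕ) : ℝ) + d + 1) / ((k : ℝ) + 1) := by
        push_cast; field_simp; ring
      have e2 : 1 + ((k : ℝ) + 1)⁻¹ * (d : ℝ) = ((k : ℝ) + d + 1) / ((k : ℝ) + 1) := by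
        field_simp; ring
      rw [e1, e2, Real.log_div (by positivity) hk.ne', Real.log_div (by positivity) hk.ne']
      ring
    have htel : ∑ k ∈ Finset.range N, Real.log (1 + ((k : ℝ) + 1)⁻¹ * ((d + 1 : ℕ) : ℝ)) =
        ∑ k ∈ Finset.range N, Real.log (1 + ((k : ℝ) + 1)⁻¹ * (d : ℝ)) + (Real.log ((N : ℝ) + d + 1) - Real.log ((d : ℝ) + 1)) := by
      have h1 : ∑ k ∈ Finset.range N, (Real.log (1 + ((k : ℝ) + 1)⁻¹ * ((d + 1 : ℕ) : ℝ)) -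
          Real.log (1 + ((k : ℝ) + 1)⁻¹ * (d : ℝ))) = Real.log ((N : ℝ) + d + 1) - Real.log ((d : ℝ) + 1) := by
        rw [Finset.sum_congr rfl hstep, Finset.sum_range_sub (fun k : ℕ => Real.log ((k : ℝ) + d + 1)) N]
        simp
      rw [Finset.sum_sub_distrib] at h1
      linarith
    have hlast : Real.log (1 + ((d : ℝ) + 1) / N) = Real.log ((N : ℝ) + d + 1) - Real.log N := by
      rw [← Real.log_div (by positivity) hN0.ne']
      congr 1
      field_simp
      ring
    rw [htel, hlast]
    push_cast
    ring

/-- **The second-order form is non-negative on the null directions.**  If `Σ c_i = 0` and all axis-level sums of `c`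
vanish, then `Σ_{i,j} c_i c_j log(‖x_i − x_j‖₁ !) ≥ 0`: by the truncated Euler product, `log d! = −Σ_{k<N} log(1 + d/(k+1))
+ d log N + O(d²/N)`; the first part contributes `≥ 0` (each `log(1 + λ‖·‖₁)` is of negative type), the linear part vanishes
on the null directions, and `N → ∞`. [cite: BergChristensenRessel1984, Ch. 3, §2] -/
theorem sum_sum_mul_log_factorial_nonneg {n : ℕ} (x : Fin n → Site 3) (c : Fin n → ℝ) (hc : ∑ i, c i = 0)
    (hlev : ∀ (k : Fin 3) (v : ℤ), ∑ i ∈ Finset.univ.filter (fun i => x i k = v), c i = 0) :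
    0 ≤ ∑ i, ∑ j, c i * c j * Real.log ((∑ k, (x i k - x j k).natAbs).factorial : ℝ) := by
  set d : Fin n → Fin n → ℕ := fun i j => ∑ k, (x i k - x j k).natAbs with hd
  -- the linear part vanishes on the null directions
  have hlin : ∑ i, ∑ j, c i * c j * (d i j : ℝ) = 0 := by
    have h1 : ∀ i j, c i * c j * (d i j : ℝ) = ∑ k, c i * c j * (((x i k - x j k).natAbs : ℕ) : ℝ) := by
      intro i j
      simp only [hd, Nat.cast_sum, Finset.mul_sum]
    simp_rw [h1]
    calc ∑ i, ∑ j, ∑ k, c i * c j * (((x i k - x j k).natAbs : ℕ) : ℝ)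
        = ∑ i, ∑ k, ∑ j, c i * c j * (((x i k - x j k).natAbs : ℕ) : ℝ) := Finset.sum_congr rfl fun i _ => Finset.sum_comm
      _ = ∑ k, ∑ i, ∑ j, c i * c j * (((x i k - x j k).natAbs : ℕ) : ℝ) := Finset.sum_comm
      _ = 0 := Finset.sum_eq_zero fun k _ =>
          sum_sum_coord_eq_zero x c k (hlev k) (fun a b => (((a - b).natAbs : ℕ) : ℝ))
  -- a bound for the remainder
  set C : ℝ := ∑ i, ∑ j, |c i| * |c j| * ((d i j : ℝ) * d i j) with hC
  have hC0 : 0 ≤ C := Finset.sum_nonneg fun i _ => Finset.sum_nonneg fun j _ => by positivity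
  have hrem : ∀ (N : ℕ), 1 ≤ N → ∀ m : ℕ, 0 ≤ ∑ j ∈ Finset.range m, Real.log (1 + ((j : ℝ) + 1) / N) ∧
      ∑ j ∈ Finset.range m, Real.log (1 + ((j : ℝ) + 1) / N) ≤ (m : ℝ) * m / N := by
    intro N hN m
    have hN0 : (0 : ℝ) < N := by exact_mod_cast hN
    constructor
    · exact Finset.sum_nonneg fun j _ => Real.log_nonneg (by
        have : (0 : ℝ) ≤ ((j : ℝ) + 1) / N := by positivity
        linarith)
    · calc ∑ j ∈ Finset.range m, Real.log (1 + ((j : ℝ) + 1) / N) ≤ ∑ j ∈ Finset.range m, ((m : ℝ) / N) := by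
            refine Finset.sum_le_sum fun j hj => ?_
            have hj' : (j : ℝ) + 1 ≤ m := by exact_mod_cast Finset.mem_range.1 hj
            calc Real.log (1 + ((j : ℝ) + 1) / N) ≤ (1 + ((j : ℝ) + 1) / N) - 1 :=
                  Real.log_le_sub_one_of_pos (by positivity)
              _ = ((j : ℝ) + 1) / N := by ring
              _ ≤ (m : ℝ) / N := by gcongr
        _ = (m : ℝ) * m / N := by rw [Finset.sum_const, Finset.card_range, nsmul_eq_mul]; ring
  -- the bound `Φ(c) ≥ −C/N` for every `N ≥ 1`
  have hmain : ∀ N : ℕ, 1 ≤ N → -(C / N) ≤ ∑ i, ∑ j, c i * c j * Real.log ((d i j).factorial : ℝ) := by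
    intro N hN
    have hN0 : (0 : ℝ) < N := by exact_mod_cast hN
    have hid : ∀ i j, c i * c j * Real.log ((d i j).factorial : ℝ) =
        -(c i * c j * ∑ k ∈ Finset.range N, Real.log (1 + ((k : ℝ) + 1)⁻¹ * d i j)) +
          Real.log N * (c i * c j * (d i j : ℝ)) +
          c i * c j * ∑ j' ∈ Finset.range (d i j), Real.log (1 + ((j' : ℝ) + 1) / N) := by
      intro i j
      rw [log_factorial_eq_sum (d i j) hN]
      ring
    have hsum : ∑ i, ∑ j, c i * c j * Real.log ((d i j).factorial : ℝ) =
        -(∑ i, ∑ j, c i * c j * ∑ k ∈ Finset.range N, Real.log (1 + ((k : ℝ) + 1)⁻¹ * d i j)) +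
          Real.log N * ∑ i, ∑ j, c i * c j * (d i j : ℝ) +
          ∑ i, ∑ j, c i * c j * ∑ j' ∈ Finset.range (d i j), Real.log (1 + ((j' : ℝ) + 1) / N) := by
      simp only [hid, Finset.sum_add_distrib, Finset.sum_neg_distrib, ← Finset.mul_sum]
    rw [hsum, hlin, mul_zero, add_zero]
    have hswap : ∑ i, ∑ j, c i * c j * ∑ k ∈ Finset.range N, Real.log (1 + ((k : ℝ) + 1)⁻¹ * d i j) =
        ∑ k ∈ Finset.range N, ∑ i, ∑ j, c i * c j * Real.log (1 + ((k : ℝ) + 1)⁻¹ * d i j) := by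
      calc ∑ i, ∑ j, c i * c j * ∑ k ∈ Finset.range N, Real.log (1 + ((k : ℝ) + 1)⁻¹ * d i j)
          = ∑ i, ∑ j, ∑ k ∈ Finset.range N, c i * c j * Real.log (1 + ((k : ℝ) + 1)⁻¹ * d i j) :=
            Finset.sum_congr rfl fun i _ => Finset.sum_congr rfl fun j _ => by rw [Finset.mul_sum]
        _ = ∑ i, ∑ k ∈ Finset.range N, ∑ j, c i * c j * Real.log (1 + ((k : ℝ) + 1)⁻¹ * d i j) :=
            Finset.sum_congr rfl fun i _ => Finset.sum_comm
        _ = ∑ k ∈ Finset.range N, ∑ i, ∑ j, c i * c j * Real.log (1 + ((k : ℝ) + 1)⁻¹ * d i j) :=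
            Finset.sum_comm
    have h1 : 0 ≤ -(∑ i, ∑ j, c i * c j * ∑ k ∈ Finset.range N, Real.log (1 + ((k : ℝ) + 1)⁻¹ * d i j)) := by
      rw [hswap, neg_nonneg]
      exact Finset.sum_nonpos fun k _ => sum_sum_mul_log_one_add_nonpos x c hc (by positivity)
    have h2 : -(C / N) ≤ ∑ i, ∑ j, c i * c j * ∑ j' ∈ Finset.range (d i j), Real.log (1 + ((j' : ℝ) + 1) / N) := by
      rw [hC, Finset.sum_div, ← Finset.sum_neg_distrib]
      refine Finset.sum_le_sum fun i _ => ?_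
      rw [Finset.sum_div, ← Finset.sum_neg_distrib]
      refine Finset.sum_le_sum fun j _ => ?_
      obtain ⟨hr0, hr1⟩ := hrem N hN (d i j)
      have habs : |c i * c j * ∑ j' ∈ Finset.range (d i j), Real.log (1 + ((j' : ℝ) + 1) / N)| ≤
          |c i| * |c j| * ((d i j : ℝ) * d i j / N) := by
        rw [abs_mul, abs_mul, abs_of_nonneg hr0]
        exact mul_le_mul_of_nonneg_left hr1 (by positivity)
      have := neg_abs_le (c i * c j * ∑ j' ∈ Finset.range (d i j), Real.log (1 + ((j' : ℝ) + 1) / N))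
      have e : -(|c i| * |c j| * ((d i j : ℝ) * d i j) / N) = -(|c i| * |c j| * ((d i j : ℝ) * d i j / N)) := by ring
      linarith
    linarith
  -- conclusion: `N → ∞`
  by_contra hneg
  push Not at hneg
  set Φ := ∑ i, ∑ j, c i * c j * Real.log ((d i j).factorial : ℝ) with hΦ
  obtain ⟨N, hN⟩ := exists_nat_gt (C / (-Φ))
  have hΦ0 : 0 < -Φ := by linarith
  have hN1 : 1 ≤ N + 1 := by omega
  have h := hmain (N + 1) hN1
  have hN0 : (0 : ℝ) < (N + 1 : ℕ) := by positivity
  -- from `h`: C / (N+1) ≥ -Φ, i.e. `N + 1 ≤ C / (-Φ)`, contradicting the choice of `N`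
  have h3 : -Φ ≤ C / ((N + 1 : ℕ) : ℝ) := by linarith
  rw [le_div_iff₀ hN0] at h3
  have h4 : ((N + 1 : ℕ) : ℝ) ≤ C / (-Φ) := by rw [le_div_iff₀ hΦ0]; linarith
  push_cast at h4
  linarith

end SmallPNegType

end Summit.CriticalPhenomena.PercolationContinuityZ3.Theorems

end
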